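import Literature.AlgebraicGeometry.Motives.HodgeLieWeightOnePeirce
import Literature.AlgebraicGeometry.Motives.HodgeLieWeightOneThetaIdeal
import Literature.AlgebraicGeometry.Motives.HodgeLieWeightOnePlusPairTwinEight
import HarnessLib

/-!
# Weight one, rank twelve, `End_Hdg = ℚ`: `Lie Hg = 𝔰𝔭₁₂` UNLESS a minimal raising tripotent of rank `2`, `3` or `4` exists
# (Moonen–Zarhin 1999 (2.3): the reduction of «`End⁰ = ℚ`, `g = 6` ⟹ `Hg = Sp₁₂`» to its Levi core)

Family `hodge`, layer `Literature/AlgebraicGeometry/Motives`; THEOREMS ONLY (no definition, no named fact; D-0026).  Written for the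
cell `pub-hodgeav-hg6` (LADDER-HodgeAV row 2, TABLE X row 1 `g6.I(1)`: brick N6 of the row-1 programme; honest framing of that cell:
HC / HC_AV / HC_CM NOT proved — this file is unconditional Hodge–Lie linear algebra, and it does NOT prove `Hg = Sp₁₂`: it isolates
exactly what is left).

* **`rankTwelve_sp_or_exists_minimal_raising`** — `H` effective polarized of weight `1`, `End_Hdg(V) = ℚ`, `dim_ℚ V = 12`.  EITHER
  every `ψ_ℂ`-skew operator of `V_ℂ` lies in `𝔥_ℂ = Lie Hg ⊗ ℂ` (i.e. `Lie Hg = 𝔰𝔭(V, ψ)`, the expected row-1 answer), OR there is a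
  raising operator `B ∈ 𝔥_ℂ` (`B V^{1,0} = 0`, `B V_ℂ ⊆ V^{1,0}`), non-zero, of MINIMAL rank `r` among such, with `2 ≤ r ≤ 4`
  (returned with its conjugate `B̄`).  PROOF (assembly of the tree's bricks): `𝔊 = 𝔥_ℂ = spanC (Lie Hg)` is bracket-closed,
  conjugation-stable, contains `Θ` (`hodgeLie_standing`, `commutator_mem_spanC`, `conjOp_mem_spanC`) and acts irreducibly on
  `V_ℂ` (`SymplecticTheta.eq_bot_or_top_of_stable`); a non-zero raising operator exists (else, by conjugation, no lowering one
  either, so `𝔥_ℂ` commutes with `Θ` by `WeightOneThetaIdeal.commute_theta_of_raising_lowering_trivial` and `V^{1,0}` is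
  stable); take one of minimal rank `r ∈ {1, …, 6}` (`Nat.find`).  `r = 1`: `WeightOneMinimalRaising.mem_of_skew_of_rank_one`
  (N4).  `r = 5`: excluded by `WeightOnePeirce.finrank_range_ne_five` (N5).  `r = 6`: every `B' B̄'|_{V^{1,0}}` is scalar
  (`WeightOnePeirce.forall_scalar_of_finrank_range_eq`, N5), so `𝔥_ℂ` is in the plus-line position
  (`SymplecticThetaTen.plusLine_of_forall_scalar`), which `not_plusPair_of_finrank_eq_twelve` (twin ideal ⟹ `8 ∣ 12`) excludes.
* **`rankTwelve_tripotent_of_minimal`** — in the second case `B̄ ∈ 𝔥_ℂ` and `B B̄ B = t B`, `B̄ B B̄ = t B̄` with `t ≠ 0`, `t̄ = t`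
  (N4, N5 §1), recorded in the shape the Levi-core analysis of `r = 2, 3, 4` starts from.

WHAT IS LEFT for «`g = 6`, `End⁰ = ℚ` ⟹ `Hg = Sp₁₂`» (Moonen–Zarhin (2.3), via the classification there): the second disjunct is
empty — a minimal raising tripotent of rank `2`, `3`, `4` in `dim V^{1,0} = 6` contradicts `ℚ`-simplicity (`HodgeLieWeightOneSimple`,
`HodgeLieWeightOneThetaIdeal`: the complex configurations `𝔰𝔭₄ ⊕ 𝔰𝔬₃` on `ℂ⁴ ⊗ ℂ³` (`r = 3`) and `𝔰𝔩₂ ⊕ 𝔰𝔬₆` on `ℂ² ⊗ ℂ⁶`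
with `Θ ∈ 𝔰𝔬₆` (`r = 4`) do occur and are excluded only by the unequal dimensions of their ideals).

## References

* [MoonenZarhin1999LowDim] B. Moonen, Yu. Zarhin, *Hodge classes on abelian varieties of low dimension*, Math. Ann. 315 (1999),
  §2 (2.3)–(2.5), §3 (3.1).
* [Deligne1982HodgeCycles] P. Deligne, *Hodge cycles on abelian varieties*, LNM 900 (1982), I §3 (Prop. 3.4, 3.6).
* [Ribet1983] K. Ribet, *Hodge classes on certain types of abelian varieties*, Amer. J. Math. 105 (1983), Theorems 1–2.
-/

noncomputable section

open scoped TensorProduct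

namespace Literature.AlgebraicGeometry.Motives

namespace HodgeStructure

universe u

variable {V : Type u} [AddCommGroup V] [Module ℚ V] [Module.Finite ℚ V] [HodgeTensorFacts.{u, u}] {n : ℤ}

set_option maxHeartbeats 1600000 in
/-- **Rank twelve, `End_Hdg = ℚ`: `Lie Hg ⊗ ℂ = 𝔰𝔭(V_ℂ, ψ_ℂ)` unless a minimal raising tripotent of rank `2`, `3` or `4` exists.**
`H` effective polarized of weight `1`, `End_Hdg(V) = ℚ`, `dim_ℚ V = 12`.  Either every `ψ_ℂ`-skew operator lies in `𝔥_ℂ`, or there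
are `B, C = B̄` with `B ∈ 𝔥_ℂ` raising, non-zero, of minimal rank `r` among the non-zero raising operators of `𝔥_ℂ`, and `2 ≤ r ≤ 4`.
[cite: MoonenZarhin1999LowDim, §2 (2.3)–(2.5) and §3 (3.1)] [cite: Deligne1982HodgeCycles, I §3 Prop. 3.4, Prop. 3.6]
[cite: Ribet1983, Theorems 1–2] -/
theorem rankTwelve_sp_or_exists_minimal_raising (H : HodgeStructure V n) (hn : n = 1) (heff : H.IsEffective)
    (ψ : H.Polarization) (hE : ∀ a ∈ H.endAlg, ∃ x : ℚ, a = x • (1 : Module.End ℚ V)) (hV : Module.finrank ℚ V = 12) :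
    (∀ Y : Module.End ℂ (ℂ ⊗[ℚ] V),
        (∀ x y, ψ.form.baseChange ℂ (Y x) y + ψ.form.baseChange ℂ x (Y y) = 0) → Y ∈ H.hodgeLieC) ∨
      ∃ B C : Module.End ℂ (ℂ ⊗[ℚ] V), B ∈ H.hodgeLieC ∧ B ≠ 0 ∧ (∀ p ∈ H.piece 1 0, B p = 0) ∧
        (∀ v, B v ∈ H.piece 1 0) ∧ (∀ v, C v = conj (B (conj v))) ∧
        (∀ B' ∈ H.hodgeLieC, B' ≠ 0 → (∀ p ∈ H.piece 1 0, B' p = 0) → (∀ v, B' v ∈ H.piece 1 0) →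
          Module.finrank ℂ (LinearMap.range B) ≤ Module.finrank ℂ (LinearMap.range B')) ∧
        2 ≤ Module.finrank ℂ (LinearMap.range B) ∧ Module.finrank ℂ (LinearMap.range B) ≤ 4 := by
  classical
  obtain ⟨hbr, hskew, -, Θ, hΘ, hΘ𝔤⟩ := hodgeLie_standing H ψ
  have hspan : H.hodgeLieC = spanC H.hodgeLie := hodgeLieC_eq_spanC H
  -- the standing hypotheses of N4/N5 for `𝔊 = 𝔥_ℂ`
  have h𝔊 : spanC H.hodgeLie ≤ H.hodgeLieC := hspan.symm.le
  have hbrC : ∀ Y ∈ spanC H.hodgeLie, ∀ Z ∈ spanC H.hodgeLie, Y * Z - Z * Y ∈ spanC H.hodgeLie :=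
    fun Y hY Z hZ => commutator_mem_spanC hbr hY hZ
  have hconj : ∀ Z ∈ spanC H.hodgeLie, ∀ Z' : Module.End ℂ (ℂ ⊗[ℚ] V), (∀ v, Z' v = conj (Z (conj v))) →
      Z' ∈ spanC H.hodgeLie := fun Z hZ Z' hZ' => conjOp_mem_spanC hZ hZ'
  have hirr : ∀ U : Submodule ℂ (ℂ ⊗[ℚ] V), (∀ Z ∈ spanC H.hodgeLie, ∀ u ∈ U, Z u ∈ U) → U = ⊥ ∨ U = ⊤ :=
    fun U hU => SymplecticTheta.eq_bot_or_top_of_stable H hn heff ψ hE H.hodgeLie hΘ hΘ𝔤 hskew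
      fun X hX u hu => hU _ (baseChange_mem_spanC hX) u hu
  obtain ⟨hP6, hQ6⟩ := finrank_pieces_eq_of_weightOne H hn heff (m := 6) (by rw [hV]) hΘ
  -- a non-zero raising operator exists
  have hexB : ∃ B ∈ spanC H.hodgeLie, B ≠ 0 ∧ (∀ p ∈ H.piece 1 0, B p = 0) ∧ (∀ v, B v ∈ H.piece 1 0) := by
    by_contra hno
    push Not at hno
    have h0 : ∀ B ∈ spanC H.hodgeLie, (∀ p ∈ H.piece 1 0, B p = 0) → (∀ v, B v ∈ H.piece 1 0) → B = 0 :=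
      fun B hB hBP hBim => by_contra fun h => by
        obtain ⟨v, hv⟩ := hno B hB h hBP
        exact hv (hBim v)
    have h0' : ∀ C ∈ spanC H.hodgeLie, (∀ q ∈ H.piece 0 1, C q = 0) → (∀ v, C v ∈ H.piece 0 1) → C = 0 := by
      intro C hC hCQ hCim
      obtain ⟨B, hB⟩ := exists_conjOp C
      have hBmem : B ∈ spanC H.hodgeLie := hconj C hC B hB
      have hBP : ∀ p ∈ H.piece 1 0, B p = 0 := fun p hp => by rw [hB, hCQ _ (conj_mem_piece H hp), map_zero]
      have hBim : ∀ v, B v ∈ H.piece 1 0 := fun v => by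
        rw [hB]
        exact conj_mem_piece H (hCim _)
      have hB0 := h0 B hBmem hBP hBim
      refine LinearMap.ext fun v => ?_
      have h : C v = conj (B (conj v)) := by rw [hB, conj_conj, conj_conj]
      rw [h, hB0, LinearMap.zero_apply, map_zero, LinearMap.zero_apply]
    have had : ∀ Z ∈ spanC H.hodgeLie, Θ * Z - Z * Θ ∈ spanC H.hodgeLie := fun Z hZ => hbrC Θ hΘ𝔤 Z hZ
    have hcomm := WeightOneThetaIdeal.commute_theta_of_raising_lowering_trivial H hn heff hΘ had h0 h0'
    subst hn
    obtain ⟨hPmem, -, hΘ10, hΘ01, -⟩ := UnitaryTheta.theta_facts H rfl heff hΘ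
    have hTfix : ∀ x : ℂ ⊗[ℚ] V, Θ x = x → x ∈ H.piece 1 0 := fun x hx => by
      have h := hPmem x
      rwa [hx, ← two_smul ℂ x, smul_smul, inv_mul_cancel₀ (two_ne_zero' ℂ), one_smul] at h
    have hPst : ∀ Z ∈ spanC H.hodgeLie, ∀ u ∈ H.piece 1 0, Z u ∈ H.piece 1 0 := fun Z hZ u hu =>
      hTfix _ (by rw [← Module.End.mul_apply, hcomm Z hZ, Module.End.mul_apply, hΘ10 u hu])
    rcases hirr _ hPst with hbot | htop
    · rw [hbot, finrank_bot] at hP6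
      exact absurd hP6 (by norm_num)
    · have hQ0 : H.piece 0 1 = ⊥ := by
        rw [eq_bot_iff]
        intro x hx
        rw [Submodule.mem_bot]
        have hxP : x ∈ H.piece 1 0 := by rw [htop]; exact Submodule.mem_top
        have h1 := hΘ10 x hxP
        rw [hΘ01 x hx, neg_eq_iff_add_eq_zero, ← two_smul ℂ x, smul_eq_zero] at h1
        exact h1.resolve_left (two_ne_zero' ℂ)
      rw [hQ0, finrank_bot] at hQ6
      exact absurd hQ6 (by norm_num)
  -- a raising operator of minimal rank
  have hexk : ∃ k, ∃ B ∈ spanC H.hodgeLie, B ≠ 0 ∧ (∀ p ∈ H.piece 1 0, B p = 0) ∧ (∀ v, B v ∈ H.piece 1 0) ∧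
      Module.finrank ℂ (LinearMap.range B) = k := by
    obtain ⟨B, hB, hB0, hBP, hBim⟩ := hexB
    exact ⟨_, B, hB, hB0, hBP, hBim, rfl⟩
  obtain ⟨B, hB, hB0, hBP, hBim, hBk⟩ := Nat.find_spec hexk
  have hmin : ∀ B' ∈ spanC H.hodgeLie, B' ≠ 0 → (∀ p ∈ H.piece 1 0, B' p = 0) → (∀ v, B' v ∈ H.piece 1 0) →
      Module.finrank ℂ (LinearMap.range B) ≤ Module.finrank ℂ (LinearMap.range B') := fun B' hB' h0 h1 h2 => by
    rw [hBk]
    exact Nat.find_min' hexk ⟨B', hB', h0, h1, h2, rfl⟩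
  obtain ⟨C, hC⟩ := exists_conjOp B
  have hC𝔊 : C ∈ spanC H.hodgeLie := hconj B hB C hC
  have hBle : LinearMap.range B ≤ H.piece 1 0 := by
    rintro _ ⟨w, rfl⟩
    exact hBim w
  have hr6 : Module.finrank ℂ (LinearMap.range B) ≤ 6 := hP6 ▸ Submodule.finrank_mono hBle
  have hr1 : 1 ≤ Module.finrank ℂ (LinearMap.range B) := by
    refine Nat.one_le_iff_ne_zero.2 fun h => hB0 ?_
    exact LinearMap.range_eq_bot.1 (Submodule.finrank_eq_zero.1 h)
  have hr5 : Module.finrank ℂ (LinearMap.range B) ≠ 5 :=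
    WeightOnePeirce.finrank_range_ne_five H ψ hn heff hΘ h𝔊 hbrC hΘ𝔤 hconj hirr hB hB0 hBP hBim hC hmin hP6
  by_cases hrk1 : Module.finrank ℂ (LinearMap.range B) = 1
  · -- rank one: `𝔤_ℂ = 𝔰𝔭_ℂ`
    left
    intro Y hY
    rw [hspan]
    exact WeightOneMinimalRaising.mem_of_skew_of_rank_one H ψ hn heff hΘ h𝔊 hbrC hΘ𝔤 hirr hB hBP hBim hC hC𝔊 hrk1 hY
  by_cases hrk6 : Module.finrank ℂ (LinearMap.range B) = 6
  · -- full rank: the plus line, excluded in rank twelve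
    exfalso
    have hscalar := WeightOnePeirce.forall_scalar_of_finrank_range_eq H ψ hn heff hΘ h𝔊 hbrC hconj hmin (hrk6.trans hP6.symm)
    have hP0 : H.piece 1 0 ≠ ⊥ := fun h => by
      rw [h, finrank_bot] at hP6
      exact absurd hP6 (by norm_num)
    obtain ⟨B₀, hB₀, C₀, -, μ₀, hB₀0, hB₀P, hB₀im, hC₀, -, -, hμ₀, -, hBC, hCB, hline, hline'⟩ :=
      SymplecticThetaTen.plusLine_of_forall_scalar H hn heff ψ hE H.hodgeLie hbr hΘ hΘ𝔤 hskew hP0 hscalar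
    rw [← hspan] at hB₀ hline hline'
    exact not_plusPair_of_finrank_eq_twelve H ψ hn heff hV hΘ hB₀ hB₀0 hB₀P hB₀im hC₀ hμ₀ hBC hCB hline hline' hE
  · right
    refine ⟨B, C, hspan ▸ hB, hB0, hBP, hBim, hC, fun B' hB' => hmin B' (hspan ▸ hB'), ?_, ?_⟩ <;> omega

/-- **The minimal raising tripotent of the second case**: `B̄ ∈ 𝔥_ℂ` and `B B̄ B = t B`, `B̄ B B̄ = t B̄` with `t ≠ 0`, `t̄ = t`
(N4 `WeightOneMinimalRaising.mul_conjOp_mul_eq_smul`, N5 `WeightOnePeirce.conjOp_mul_conjOp_mul`) — recorded in the shape the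
Levi-core analysis of the cases `r = 2, 3, 4` starts from. [cite: MoonenZarhin1999LowDim, §2 (2.3)–(2.5)] [cite: Deligne1982HodgeCycles, I §3 Prop. 3.4, Prop. 3.6] -/
theorem rankTwelve_tripotent_of_minimal (H : HodgeStructure V n) (hn : n = 1) (heff : H.IsEffective) (ψ : H.Polarization)
    {B C : Module.End ℂ (ℂ ⊗[ℚ] V)} (hB : B ∈ H.hodgeLieC) (hB0 : B ≠ 0) (hBP : ∀ p ∈ H.piece 1 0, B p = 0)
    (hBim : ∀ v, B v ∈ H.piece 1 0) (hC : ∀ v, C v = conj (B (conj v)))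
    (hmin : ∀ B' ∈ H.hodgeLieC, B' ≠ 0 → (∀ p ∈ H.piece 1 0, B' p = 0) → (∀ v, B' v ∈ H.piece 1 0) →
      Module.finrank ℂ (LinearMap.range B) ≤ Module.finrank ℂ (LinearMap.range B')) :
    C ∈ H.hodgeLieC ∧ ∃ t : ℂ, t ≠ 0 ∧ starRingEnd ℂ t = t ∧ B * C * B = t • B ∧ C * B * C = t • C := by
  classical
  obtain ⟨hbr, -, -, Θ, hΘ, hΘ𝔤⟩ := hodgeLie_standing H ψ
  have hspan : H.hodgeLieC = spanC H.hodgeLie := hodgeLieC_eq_spanC H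
  rw [hspan] at hB hmin
  have hbrC : ∀ Y ∈ spanC H.hodgeLie, ∀ Z ∈ spanC H.hodgeLie, Y * Z - Z * Y ∈ spanC H.hodgeLie :=
    fun Y hY Z hZ => commutator_mem_spanC hbr hY hZ
  have hC𝔊 : C ∈ spanC H.hodgeLie := conjOp_mem_spanC hB hC
  obtain ⟨t, ht, hBCB⟩ :=
    WeightOneMinimalRaising.mul_conjOp_mul_eq_smul H ψ hn heff hΘ hspan.symm.le hbrC hB hB0 hBP hBim hC hC𝔊 hmin
  obtain ⟨hCBC, htreal⟩ := WeightOnePeirce.conjOp_mul_conjOp_mul hC ht hB0 hBCB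
  exact ⟨hspan ▸ hC𝔊, t, ht, htreal, hBCB, hCBC⟩

end HodgeStructure

end Literature.AlgebraicGeometry.Motives
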